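import Literature.NumberTheory.Weil1964.AdelicMetaplecticGroup
import Literature.NumberTheory.Automorphic.AdelicSchwartzBruhatLF
import HarnessLib

/-!
# `Mp_ψ(W_𝔸)ᶜᵒⁿᵗ`: the adelic metaplectic group OF RECORD (LF-continuous implementers)

[GelbartRogawski1991, §3.1 p. 454] works with pairs `(g, M_g)`, `g ∈ Sp_𝐀(W)`, `M_g` an operator implementing `g` on
the oscillator representation; Weil's metaplectic operators are automorphisms of the topological vector space
`𝒮(X_A)` [Weil1964, Chap. I n° 11–13; Chap. III n° 39 p. 189]. The tree's `adelicMp F ι T = MpPsi (adelicSchrodinger F ι T)`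
(`AdelicMetaplecticGroup`) is the ALGEBRAIC group of all implementing pairs on the smooth model `𝒮(𝔸_F^ι)`; this file
cuts out the subgroup

  `adelicMpCont F ι T := { p ∈ Mp_ψ(W_𝔸) | toOp p, (toOp p)⁻¹ are LF-continuous }`
  (`= (lfUnits F ι).comap toOp`, `AdelicSchwartzBruhatLF.IsLFContinuous` = finite continuous expansion on every
  Fréchet piece `𝓢(X_∞) ⊗ Φ_f` of `𝒮(𝔸_F^ι) = 𝓢(X_∞) ⊗ 𝒮(X_f)`),

which is the `Mp` the compatible-splitting record is instantiated at (ruling J-W2glob-7 (α′)): asking the implementers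
to be continuous is WEAKER than or equal to print, and it is what makes archimedean tensor-stripping and the
continuous Schur lemma applicable to every element. It carries the SUBSPACE topology of `AdelicMetaplecticGroup` §4
(initial topology of the `π`-orbit maps and the matrix coefficients), and the Θ-forced lift `adelicThetaLift` restricts to
`adelicLiftableCont := adelicThetaLift⁻¹(adelicMpCont) ≤ adelicLiftable`, a subgroup for free; the sequel
(`AdelicMetaplecticGenerators`) puts the rational points `Sp(W)(F)` inside it generator by generator. Kernel only.
-/

noncomputable section

namespace Literature.NumberTheory.Weil1964

open Literature.RepresentationTheory.HeisenbergGroup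
open Literature.NumberTheory.Automorphic
open NumberField
open scoped Matrix Classical

variable (F : Type) [Field F] [NumberField F] (ι : Type) [Fintype ι] [DecidableEq ι]
variable (T : Matrix ι ι (AdeleRing (𝓞 F) F))

/-! ## §1. The subgroup -/

/-- **`Mp_ψ(W_𝔸)ᶜᵒⁿᵗ`** — the implementing pairs `(g, M)` with `M` and `M⁻¹` LF-continuous on `𝒮(𝔸_F^ι)`:
`(lfUnits F ι).comap toOp`. The metaplectic group of record. [cite: GelbartRogawski1991, §3.1 p. 454; Weil1964, Chap. I
n° 11–13 (metaplectic operators are automorphisms of the topological vector space 𝒮(X))] -/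
def adelicMpCont : Subgroup (adelicMp F ι T) :=
  (lfUnits F ι).comap (MpPsi.toOp (adelicSchrodinger F ι T))

variable {F ι T}

/-- Membership: `p ∈ Mp_ψ(W_𝔸)ᶜᵒⁿᵗ ↔ toOp p ∈ lfUnits`. [folklore] -/
theorem mem_adelicMpCont_iff (p : adelicMp F ι T) :
    p ∈ adelicMpCont F ι T ↔ MpPsi.toOp (adelicSchrodinger F ι T) p ∈ lfUnits F ι :=
  Iff.rfl

/-- Membership, unfolded: both `toOp p` and its inverse are LF-continuous. [folklore] -/
theorem mem_adelicMpCont_iff' (p : adelicMp F ι T) :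
    p ∈ adelicMpCont F ι T ↔
      IsLFContinuous ((MpPsi.toOp (adelicSchrodinger F ι T) p : piSchwartzBruhat F ι ≃ₗ[ℂ] piSchwartzBruhat F ι) :
          piSchwartzBruhat F ι →ₗ[ℂ] piSchwartzBruhat F ι) ∧
        IsLFContinuous ((MpPsi.toOp (adelicSchrodinger F ι T) p).symm :
          piSchwartzBruhat F ι →ₗ[ℂ] piSchwartzBruhat F ι) :=
  Iff.rfl

/-- A pair whose operator and inverse operator agree with tensor-product automorphisms `A ⊗ B`, `A' ⊗ B'` (`A, A'`
continuous on `𝓢(X_∞)`) lies in `Mp_ψ(W_𝔸)ᶜᵒⁿᵗ` — the form used for the Levi / unipotent / Weyl implementers.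
[folklore] -/
theorem mem_adelicMpCont_of_tensor (p : adelicMp F ι T)
    (A A' : SchwartzMap (ι → mixedEmbedding.mixedSpace F) ℂ →L[ℂ] SchwartzMap (ι → mixedEmbedding.mixedSpace F) ℂ)
    (B B' : FinSB F ι →ₗ[ℂ] FinSB F ι)
    (hM : ∀ Φ, MpPsi.toOp (adelicSchrodinger F ι T) p Φ =
      adelicTensorEnd (A : SchwartzMap (ι → mixedEmbedding.mixedSpace F) ℂ →ₗ[ℂ]
        SchwartzMap (ι → mixedEmbedding.mixedSpace F) ℂ) B Φ)
    (hM' : ∀ Φ, (MpPsi.toOp (adelicSchrodinger F ι T) p).symm Φ =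
      adelicTensorEnd (A' : SchwartzMap (ι → mixedEmbedding.mixedSpace F) ℂ →ₗ[ℂ]
        SchwartzMap (ι → mixedEmbedding.mixedSpace F) ℂ) B' Φ) :
    p ∈ adelicMpCont F ι T :=
  mem_lfUnits_of_tensor _ A A' B B' hM hM'

variable (F ι T)

/-- `π` on `Mp_ψ(W_𝔸)ᶜᵒⁿᵗ`. [cite: GelbartRogawski1991, §3.1 p. 454] -/
def adelicMpCont.proj : adelicMpCont F ι T →* symplecticGroup (polar (adelicForm F ι T)) :=
  (MpPsi.proj (adelicSchrodinger F ι T)).comp (adelicMpCont F ι T).subtype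

/-- `ω_ψ` on `Mp_ψ(W_𝔸)ᶜᵒⁿᵗ` (`(g, M) ↦ M`). [cite: GelbartRogawski1991, §3.1 p. 454] -/
def adelicMpCont.omega : Representation ℂ (adelicMpCont F ι T) (piSchwartzBruhat F ι) :=
  (omegaPsi (adelicSchrodinger F ι T)).comp (adelicMpCont F ι T).subtype

variable {F ι T}

/-- `proj p = π p`. [folklore] -/
@[simp] theorem adelicMpCont.proj_apply (p : adelicMpCont F ι T) :
    adelicMpCont.proj F ι T p = MpPsi.proj (adelicSchrodinger F ι T) p := rfl

/-- `omega p = ω_ψ p = toOp p`. [folklore] -/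
@[simp] theorem adelicMpCont.omega_apply (p : adelicMpCont F ι T) :
    adelicMpCont.omega F ι T p = omegaPsi (adelicSchrodinger F ι T) p := rfl

/-- Every operator `ω(p)`, `p ∈ Mp_ψ(W_𝔸)ᶜᵒⁿᵗ`, is LF-continuous. [folklore] -/
theorem adelicMpCont.isLFContinuous_omega (p : adelicMpCont F ι T) :
    IsLFContinuous (adelicMpCont.omega F ι T p) :=
  p.2.1

/-! ## §2. Topology: the subspace topology of `AdelicMetaplecticGroup` §4

`adelicMpCont F ι T` is a subtype of `adelicMp F ι T`, so it inherits `topologicalSpace_adelicMp` (instance found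
automatically); we record the continuity interface. -/

/-- A map into `Mp_ψ(W_𝔸)ᶜᵒⁿᵗ` is continuous iff it is continuous into `Mp_ψ(W_𝔸)` — i.e. (file `AdelicMetaplecticGroup`,
`continuous_into_adelicMp_iff`) iff all `π`-orbit maps and all matrix coefficients along it are continuous. [folklore] -/
theorem continuous_into_adelicMpCont_iff {Z : Type*} [TopologicalSpace Z] (f : Z → adelicMpCont F ι T) :
    Continuous f ↔ Continuous fun z => (f z : adelicMp F ι T) :=
  ⟨fun h => continuous_subtype_val.comp h, fun h => continuous_induced_rng.2 h⟩

/-- The inclusion `Mp_ψ(W_𝔸)ᶜᵒⁿᵗ → Mp_ψ(W_𝔸)` is continuous. [folklore] -/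
theorem continuous_adelicMpCont_subtype :
    Continuous fun p : adelicMpCont F ι T => (p : adelicMp F ι T) :=
  continuous_subtype_val

/-- The orbit maps of `π` are continuous on `Mp_ψ(W_𝔸)ᶜᵒⁿᵗ`. [folklore] -/
theorem adelicMpCont.continuous_proj_apply (w : (ι → AdeleRing (𝓞 F) F) × (ι → AdeleRing (𝓞 F) F)) :
    Continuous fun p : adelicMpCont F ι T =>
      ((adelicMpCont.proj F ι T p : symplecticGroup (polar (adelicForm F ι T))) :
        ((ι → AdeleRing (𝓞 F) F) × (ι → AdeleRing (𝓞 F) F)) ≃ₗ[AdeleRing (𝓞 F) F]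
          ((ι → AdeleRing (𝓞 F) F) × (ι → AdeleRing (𝓞 F) F))) w :=
  Continuous.comp (f := fun p : adelicMpCont F ι T => (p : adelicMp F ι T)) (_root_.Literature.NumberTheory.Weil1964.continuous_proj_apply w) continuous_subtype_val

/-- The matrix coefficients `p ↦ (ω(p) Φ)(x)` are continuous on `Mp_ψ(W_𝔸)ᶜᵒⁿᵗ`. [folklore] -/
theorem adelicMpCont.continuous_omega_apply (Φ : piSchwartzBruhat F ι) (x : ι → AdeleRing (𝓞 F) F) :
    Continuous fun p : adelicMpCont F ι T =>
      ((adelicMpCont.omega F ι T p Φ : piSchwartzBruhat F ι) : (ι → AdeleRing (𝓞 F) F) → ℂ) x :=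
  Continuous.comp (f := fun p : adelicMpCont F ι T => (p : adelicMp F ι T)) (continuous_omegaPsi_apply Φ x)
    continuous_subtype_val

/-! ## §3. The Θ-forced lift into `Mp_ψ(W_𝔸)ᶜᵒⁿᵗ` -/

variable (T)

/-- **`adelicLiftableCont`**: the `g ∈ adelicLiftable` whose Θ-forced lift `adelicThetaLift g` is LF-continuous (with its
inverse) — the preimage of `Mp_ψ(W_𝔸)ᶜᵒⁿᵗ` under the homomorphism `adelicThetaLift`, hence a subgroup. The sequel shows
it contains the rational points `Sp(W)(F)`. [cite: Weil1964, Chap. III n° 40 p. 190] -/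
def adelicLiftableCont (hT : Function.Surjective fun y : ι → AdeleRing (𝓞 F) F => T *ᵥ y) :
    Subgroup (adelicLiftable F ι T) :=
  (adelicMpCont F ι T).comap (adelicThetaLift T hT)

variable {T}

/-- Membership in `adelicLiftableCont`. [folklore] -/
theorem mem_adelicLiftableCont_iff (hT : Function.Surjective fun y : ι → AdeleRing (𝓞 F) F => T *ᵥ y)
    (g : adelicLiftable F ι T) : g ∈ adelicLiftableCont T hT ↔ adelicThetaLift T hT g ∈ adelicMpCont F ι T :=
  Iff.rfl

/-- **Criterion**: `g ∈ adelicLiftableCont` as soon as SOME Θ-fixing pair over `g` lies in `Mp_ψ(W_𝔸)ᶜᵒⁿᵗ` (by Θ-rigidity that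
pair IS the forced lift). This is how the generators are put in: exhibit an explicit LF-continuous Θ-fixing implementer.
[cite: Weil1964, Chap. III n° 41 Thm 6 p. 193] -/
theorem mem_adelicLiftableCont_of_mem (hT : Function.Surjective fun y : ι → AdeleRing (𝓞 F) F => T *ᵥ y)
    {p : adelicMp F ι T} (hΘ : p ∈ adelicMpTheta F ι T) (hc : p ∈ adelicMpCont F ι T) :
    (⟨MpPsi.proj _ p, ⟨⟨p, hΘ⟩, rfl⟩⟩ : adelicLiftable F ι T) ∈ adelicLiftableCont T hT := by
  rw [mem_adelicLiftableCont_iff, ← eq_adelicThetaLift T hT hΘ]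
  exact hc

variable (T)

/-- **GR91's `i` / Weil's `r_F` with values in the group of record**: the Θ-forced lift restricted to
`adelicLiftableCont →* Mp_ψ(W_𝔸)ᶜᵒⁿᵗ`. [cite: GelbartRogawski1991, §3.1 p. 454; Weil1964, Chap. III n° 40 p. 190] -/
def adelicThetaLiftCont (hT : Function.Surjective fun y : ι → AdeleRing (𝓞 F) F => T *ᵥ y) :
    adelicLiftableCont T hT →* adelicMpCont F ι T :=
  ((adelicThetaLift T hT).comp (adelicLiftableCont T hT).subtype).codRestrict _ fun g => g.2

variable {T}

/-- Underlying pair of `adelicThetaLiftCont g` is `adelicThetaLift g`. [folklore] -/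
@[simp] theorem coe_adelicThetaLiftCont (hT : Function.Surjective fun y : ι → AdeleRing (𝓞 F) F => T *ᵥ y)
    (g : adelicLiftableCont T hT) :
    (adelicThetaLiftCont T hT g : adelicMp F ι T) = adelicThetaLift T hT g := rfl

/-- `π ∘ i = id` on `adelicLiftableCont`. [cite: Weil1964, Chap. III n° 40 p. 190] -/
@[simp] theorem proj_adelicThetaLiftCont (hT : Function.Surjective fun y : ι → AdeleRing (𝓞 F) F => T *ᵥ y)
    (g : adelicLiftableCont T hT) :
    adelicMpCont.proj F ι T (adelicThetaLiftCont T hT g) = ((g : adelicLiftable F ι T) : symplecticGroup _) := by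
  rw [adelicMpCont.proj_apply, coe_adelicThetaLiftCont, proj_adelicThetaLift]

/-- **Θ-invariance** of the lifted operators: `Θ(ω(i g) Φ) = Θ(Φ)`. [cite: Weil1964, Chap. III n° 41 Thm 6 p. 193] -/
theorem thetaDist_omega_adelicThetaLiftCont (hT : Function.Surjective fun y : ι → AdeleRing (𝓞 F) F => T *ᵥ y)
    (g : adelicLiftableCont T hT) (Φ : piSchwartzBruhat F ι) :
    thetaDist F ι (adelicMpCont.omega F ι T (adelicThetaLiftCont T hT g) Φ : (ι → AdeleRing (𝓞 F) F) → ℂ) =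
      thetaDist F ι (Φ : (ι → AdeleRing (𝓞 F) F) → ℂ) :=
  thetaDist_omegaPsi_adelicThetaLift T hT g Φ

/-- **Uniqueness** in the group of record: a Θ-fixing pair of `Mp_ψ(W_𝔸)ᶜᵒⁿᵗ` IS the lift of its projection.
[cite: Weil1964, Chap. III n° 41 Thm 6 p. 193] -/
theorem eq_adelicThetaLiftCont (hT : Function.Surjective fun y : ι → AdeleRing (𝓞 F) F => T *ᵥ y)
    {p : adelicMpCont F ι T} (hΘ : (p : adelicMp F ι T) ∈ adelicMpTheta F ι T) :
    p = adelicThetaLiftCont T hT ⟨⟨MpPsi.proj _ (p : adelicMp F ι T), ⟨⟨p, hΘ⟩, rfl⟩⟩,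
      mem_adelicLiftableCont_of_mem hT hΘ p.2⟩ :=
  Subtype.ext (eq_adelicThetaLift T hT hΘ)

/-- A homomorphism into `Mp_ψ(W_𝔸)ᶜᵒⁿᵗ` is continuous iff its composite with the inclusion is; in particular the
continuity of `i` on the rational points is decided by `continuous_into_adelicMp_iff` (orbit maps + matrix coefficients).
[folklore] -/
theorem continuous_adelicThetaLiftCont_iff (hT : Function.Surjective fun y : ι → AdeleRing (𝓞 F) F => T *ᵥ y)
    [TopologicalSpace (adelicLiftableCont T hT)] :
    Continuous (adelicThetaLiftCont T hT) ↔
      Continuous fun g : adelicLiftableCont T hT => adelicThetaLift T hT g :=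
  continuous_into_adelicMpCont_iff _

end Literature.NumberTheory.Weil1964

end
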